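import Literature.MathematicalPhysics.AQFT.SakaiRadonNikodym
import HarnessLib

/-!
# Rieffel–van Daele's Lemma 4.5: `T J x' J T = λ(2 − R) x R + λ̄ R x (2 − R)`

Let `M` be a von Neumann algebra with cyclic and separating vector `Ω`, `𝒦 = closure(M_sa Ω)` with
its operators `R, T, J` and `B = P − Q = JT`. Rieffel–van Daele (*A bounded operator approach to
Tomita–Takesaki theory*, Pacific J. Math. 69 (1977)):

> LEMMA 4.5. Let `x' ∈ M'`. Then for any `λ ∈ ℂ` with `Re(λ) > 0` there is an `x ∈ M` such that
> `T J x' J T = λ(2 − R) x R + λ̄ R x (2 − R)`.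

We follow the printed proof: from Lemma 4.3 (`sakaiRN`, with `x` replaced by `x/2`),
`⟨yω, x'ω⟩ = λ⟨yω, xω⟩ + λ̄⟨xω, yω⟩` for `y ∈ M_s`, extended to all `y ∈ M` "if we change the third `y`
to `y*`", then `y ↦ z*y`; with `y, z ∈ M` from Corollary 4.4 (`JTy'ω = yω`, `JTz'ω = zω`), the rules
`TJuω = (2 − R)u*ω` (`u ∈ M`), `TJu'ω = Ru'*ω` (`u' ∈ M'`) and cyclicity of `ω` for `M'` give the
operator identity. In Mathlib's convention for `⟪·, ·⟫` (conjugate-linear in the first variable)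
the parameter is `μ = λ̄` (so `Re μ = Re λ`), i.e. we obtain
`T (J x' J) T = μ̄ (2 − R) x R + μ R x (2 − R)`.

## Main definitions and results

* `tomitaJ hstd` — the modular conjugation `J` of `(M, Ω)` (the `modJ` of `𝒦`); `conjJ` — the
  complex-linear operator `v ↦ J x' J v`.
* `modB_apply_of_mem`, `modB_apply_of_mem_commutant` — `TJuΩ = (2−R)u*Ω`, `TJu'Ω = Ru'*Ω`.
* `commutation_lemma` — Lemma 4.5.

## References
* M. A. Rieffel, A. van Daele, *A bounded operator approach to Tomita–Takesaki theory*, Pacific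
  J. Math. 69 (1977) 187–221, Lemma 4.5 (with Lemma 4.3, Cor. 4.4). [RieffelVandaele1977]
-/

noncomputable section

open Complex ContinuousLinearMap Filter
open _root_.Topology
open scoped InnerProductSpace ComplexConjugate

set_option synthInstance.maxHeartbeats 200000

namespace Literature.MathematicalPhysics.AQFT

open Literature.Analysis.OperatorTheory

attribute [local instance] Literature.Analysis.OperatorTheory.realIPS

variable {H : Type*} [NormedAddCommGroup H] [InnerProductSpace ℂ H] [CompleteSpace H]
variable {M : VonNeumannAlgebra H} {Ω : H}

/-! ### Self-adjoint decomposition in a von Neumann algebra -/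

/-- `A = A₁ + i A₂`, `A* = A₁ − i A₂` with `A₁, A₂` self-adjoint in the same von Neumann algebra.
[folklore] -/
theorem exists_sa_decomp (S : VonNeumannAlgebra H) {A : H →L[ℂ] H} (hA : A ∈ S) :
    ∃ A₁ A₂ : H →L[ℂ] H, A₁ ∈ S ∧ A₂ ∈ S ∧ IsSelfAdjoint A₁ ∧ IsSelfAdjoint A₂ ∧
      A = A₁ + I • A₂ ∧ star A = A₁ - I • A₂ := by
  set A₁ : H →L[ℂ] H := (2⁻¹ : ℂ) • (A + star A) with hA₁
  set A₂ : H →L[ℂ] H := (-(2⁻¹ : ℂ) * I) • (A - star A) with hA₂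
  have hA₁M : A₁ ∈ S := S.toStarSubalgebra.smul_mem (add_mem hA (star_mem hA)) _
  have hA₂M : A₂ ∈ S := S.toStarSubalgebra.smul_mem (sub_mem hA (star_mem hA)) _
  have hA₁sa : IsSelfAdjoint A₁ := by
    rw [hA₁, IsSelfAdjoint, star_smul, star_add, star_star, add_comm]
    congr 1
    simp
  have hA₂sa : IsSelfAdjoint A₂ := by
    rw [hA₂, IsSelfAdjoint, star_smul, star_sub, star_star]
    rw [show star (-(2⁻¹ : ℂ) * I) = (2⁻¹ : ℂ) * I by simp, ← neg_sub A, smul_neg, ← neg_smul]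
    congr 1
    ring
  have hdec : A = A₁ + I • A₂ := by
    rw [hA₁, hA₂, smul_smul, show I * (-(2⁻¹ : ℂ) * I) = 2⁻¹ by
      rw [mul_comm, mul_assoc, I_mul_I]; ring, smul_add, smul_sub, add_add_sub_cancel, ← add_smul]
    norm_num
  clear_value A₁ A₂
  refine ⟨A₁, A₂, hA₁M, hA₂M, hA₁sa, hA₂sa, hdec, ?_⟩
  have h := congrArg star hdec
  rw [star_add, hA₁sa.star_eq, star_smul, hA₂sa.star_eq, Complex.star_def, Complex.conj_I, neg_smul,
    ← sub_eq_add_neg] at h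
  exact h

/-! ### The modular conjugation of `(M, Ω)` -/

section J

variable (M Ω)

/-- `𝒦 ∩ i𝒦 = 0` for a standard vector. [cite: RieffelVandaele1977, Prop. 4.1] -/
theorem tomitaK_sep (hstd : IsStandardVector M Ω) :
    ∀ x, x ∈ tomitaK M Ω → x ∈ mulI (tomitaK M Ω) → x = 0 :=
  tomitaK_inf_mulI hstd.2

/-- `𝒦 + i𝒦` is dense for a standard vector. [cite: RieffelVandaele1977, Prop. 4.1] -/
theorem tomitaK_dense (hstd : IsStandardVector M Ω) :
    Dense ((tomitaK M Ω ⊔ mulI (tomitaK M Ω) : Submodule ℝ H) : Set H) :=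
  dense_tomitaK_sup hstd.1

/-- **The modular conjugation `J`** of `(M, Ω)` (the `J` of the standard subspace `𝒦 = closure(M_sa Ω)`).
[cite: RieffelVandaele1977, Def. 2.1 and §4] -/
def tomitaJ (hstd : IsStandardVector M Ω) : H ≃ₗᵢ⋆[ℂ] H :=
  modJ (tomitaK M Ω) (tomitaK_sep M Ω hstd) (tomitaK_dense M Ω hstd)

variable {M Ω}
variable (hstd : IsStandardVector M Ω)

/-- `J² = 1`. [cite: RieffelVandaele1977, Prop. 2.2 (3)] -/
theorem tomitaJ_tomitaJ (x : H) : tomitaJ M Ω hstd (tomitaJ M Ω hstd x) = x := modJ_modJ _ _ _ x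

/-- `⟪J u, J v⟫ = ⟪v, u⟫`. [cite: RieffelVandaele1977, Prop. 3.1] -/
theorem inner_tomitaJ_tomitaJ (u v : H) : ⟪tomitaJ M Ω hstd u, tomitaJ M Ω hstd v⟫_ℂ = ⟪v, u⟫_ℂ :=
  inner_modJ_modJ _ _ _ u v

/-- `⟪u, J v⟫ = ⟪v, J u⟫` ("`⟨Jξ, η⟩ = ⟨Jη, ξ⟩`", Prop. 3.1). [cite: RieffelVandaele1977, Prop. 3.1] -/
theorem inner_tomitaJ_swap (u v : H) : ⟪u, tomitaJ M Ω hstd v⟫_ℂ = ⟪v, tomitaJ M Ω hstd u⟫_ℂ := by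
  conv_lhs => rw [← tomitaJ_tomitaJ hstd u]
  rw [inner_tomitaJ_tomitaJ]

/-- `J (T x) = (P − Q) x`. [cite: RieffelVandaele1977, Def. 2.1] -/
theorem tomitaJ_modT (x : H) : tomitaJ M Ω hstd (modT (tomitaK M Ω) x) = modB (tomitaK M Ω) x :=
  modJ_modT _ _ _ x

/-- `T (J x) = (P − Q) x` (`T J = J T`). [cite: RieffelVandaele1977, Prop. 2.2 (4)] -/
theorem modT_tomitaJ (x : H) : modT (tomitaK M Ω) (tomitaJ M Ω hstd x) = modB (tomitaK M Ω) x := by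
  rw [tomitaJ, modT_modJ, modJ_modT]

/-- **The complex-linear operator `J x' J`**. [cite: RieffelVandaele1977, Thm. 4.2 and Lemma 4.5] -/
def conjJ (x' : H →L[ℂ] H) : H →L[ℂ] H where
  toFun v := tomitaJ M Ω hstd (x' (tomitaJ M Ω hstd v))
  map_add' u v := by simp only [map_add]
  map_smul' c v := by
    simp only [RingHom.id_apply]
    rw [LinearIsometryEquiv.map_smulₛₗ, map_smul, LinearIsometryEquiv.map_smulₛₗ, starRingEnd_self_apply]
  cont := (tomitaJ M Ω hstd).continuous.comp (x'.continuous.comp (tomitaJ M Ω hstd).continuous)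

/-- Unfolding `conjJ`. [cite: RieffelVandaele1977, Thm. 4.2] -/
theorem conjJ_apply (x' : H →L[ℂ] H) (v : H) :
    conjJ hstd x' v = tomitaJ M Ω hstd (x' (tomitaJ M Ω hstd v)) := rfl

/-- `J (J x' J) J = x'`. [cite: RieffelVandaele1977, Thm. 4.2] -/
theorem conjJ_conjJ (x' : H →L[ℂ] H) : conjJ hstd (conjJ hstd x') = x' := by
  ext v; simp [conjJ_apply, tomitaJ_tomitaJ]

/-- `x' ↦ J x' J` is additive. [folklore] -/
theorem conjJ_add (x' y' : H →L[ℂ] H) : conjJ hstd (x' + y') = conjJ hstd x' + conjJ hstd y' := by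
  ext v; simp [conjJ_apply]

/-- `x' ↦ J x' J` is conjugate-homogeneous. [folklore] -/
theorem conjJ_smul (c : ℂ) (x' : H →L[ℂ] H) : conjJ hstd (c • x') = conj c • conjJ hstd x' := by
  ext v; simp [conjJ_apply, LinearIsometryEquiv.map_smulₛₗ]

/-- `J x' J` is multiplicative. [folklore] -/
theorem conjJ_mul (x' y' : H →L[ℂ] H) : conjJ hstd (x' * y') = conjJ hstd x' * conjJ hstd y' := by
  ext v; simp [conjJ_apply, tomitaJ_tomitaJ]

/-- `J x'* J = (J x' J)*`. [folklore] -/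
theorem conjJ_star (x' : H →L[ℂ] H) : conjJ hstd (star x') = star (conjJ hstd x') := by
  rw [ContinuousLinearMap.star_eq_adjoint, ContinuousLinearMap.star_eq_adjoint]
  refine ContinuousLinearMap.ext fun v => ext_inner_left ℂ fun w => ?_
  rw [ContinuousLinearMap.adjoint_inner_right, conjJ_apply, conjJ_apply, inner_tomitaJ_swap,
    ContinuousLinearMap.adjoint_inner_left, ← inner_tomitaJ_tomitaJ hstd, tomitaJ_tomitaJ]

end J

/-! ### `TJ uΩ = (2 − R) u* Ω` and `TJ u'Ω = R u'* Ω` -/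

section BRules

/-- For `u ∈ M_sa`: `(P − Q)(uΩ) = (2 − R)(uΩ)` ("`Puω = uω`, so `TJuω = (2 − P − Q)uω`").
[cite: RieffelVandaele1977, Lemma 4.5 (proof)] -/
theorem modB_apply_of_mem_sa {u : H →L[ℂ] H} (huM : u ∈ M) (husa : IsSelfAdjoint u) :
    modB (tomitaK M Ω) (u Ω) = (2 - modR (tomitaK M Ω)) (u Ω) := by
  rw [modB_apply, sub_apply, two_apply, modR_apply, starProjection_apply_mem huM husa, two_smul]
  abel

/-- For `u' ∈ M'_sa`: `(P − Q)(u'Ω) = R(u'Ω)` ("`Qu'ω = 0`"). [cite: RieffelVandaele1977, Lemma 4.5 (proof)] -/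
theorem modB_apply_of_mem_commutant_sa {u' : H →L[ℂ] H} (huM : u' ∈ M.commutant)
    (husa : IsSelfAdjoint u') : modB (tomitaK M Ω) (u' Ω) = modR (tomitaK M Ω) (u' Ω) := by
  rw [modB_apply, modR_apply, starProjection_mulI_apply_commutant huM husa, sub_zero, add_zero]

/-- **`TJ uΩ = (2 − R) u*Ω` for `u ∈ M`** (conjugate linearity). [cite: RieffelVandaele1977, Lemma 4.5 (proof)] -/
theorem modB_apply_of_mem {u : H →L[ℂ] H} (huM : u ∈ M) :
    modB (tomitaK M Ω) (u Ω) = (2 - modR (tomitaK M Ω)) ((star u) Ω) := by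
  obtain ⟨u₁, u₂, h₁M, h₂M, h₁sa, h₂sa, hdec, hdec'⟩ := exists_sa_decomp M huM
  rw [hdec', hdec, add_apply, sub_apply u₁ (I • u₂) Ω, smul_apply, map_add, map_sub, modB_smul,
    Complex.conj_I, neg_smul, modB_apply_of_mem_sa h₁M h₁sa, modB_apply_of_mem_sa h₂M h₂sa, map_smul]
  abel

/-- **`TJ u'Ω = R u'*Ω` for `u' ∈ M'`**. [cite: RieffelVandaele1977, Lemma 4.5 (proof)] -/
theorem modB_apply_of_mem_commutant {u' : H →L[ℂ] H} (huM : u' ∈ M.commutant) :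
    modB (tomitaK M Ω) (u' Ω) = modR (tomitaK M Ω) ((star u') Ω) := by
  obtain ⟨u₁, u₂, h₁M, h₂M, h₁sa, h₂sa, hdec, hdec'⟩ := exists_sa_decomp M.commutant huM
  rw [hdec', hdec, add_apply, sub_apply u₁ (I • u₂) Ω, smul_apply, map_add, map_sub, modB_smul,
    Complex.conj_I, neg_smul, modB_apply_of_mem_commutant_sa h₁M h₁sa,
    modB_apply_of_mem_commutant_sa h₂M h₂sa, map_smul, sub_eq_add_neg]

end BRules

/-! ### Operators determined by matrix elements on `M'Ω` -/

/-- Two operators with equal matrix elements `⟪y'Ω, · z'Ω⟫`, `y', z' ∈ M'`, are equal when `Ω` is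
cyclic for `M'`. [folklore] -/
theorem ext_of_cyclic_commutant (hcyc : IsCyclicVector M.commutant Ω) {X Y : H →L[ℂ] H}
    (h : ∀ y' ∈ M.commutant, ∀ z' ∈ M.commutant, ⟪y' Ω, X (z' Ω)⟫_ℂ = ⟪y' Ω, Y (z' Ω)⟫_ℂ) : X = Y := by
  refine hcyc.ext_on fun z' hz' => ?_
  -- `X (z'Ω) = Y (z'Ω)` by density in the first slot
  have hc1 : Continuous fun a : H => ⟪a, X (z' Ω)⟫_ℂ := by fun_prop
  have hc2 : Continuous fun a : H => ⟪a, Y (z' Ω)⟫_ℂ := by fun_prop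
  have heq := Continuous.ext_on hcyc hc1 hc2 (by
    rintro _ ⟨y', rfl⟩
    exact h y' y'.2 z' hz')
  exact ext_inner_left ℂ fun a => congrFun heq a

/-! ### Lemma 4.5 -/

section Lemma45

variable (hstd : IsStandardVector M Ω)

/-- `⟪k, v⟫_ℝ = ⟪k, P v⟫_ℝ` for `k ∈ 𝒦`. [folklore] -/
theorem real_inner_eq_inner_starProjection {k v : H} (hk : k ∈ tomitaK M Ω) :
    ⟪k, v⟫_ℝ = ⟪k, (tomitaK M Ω).starProjection v⟫_ℝ := by
  rw [← Submodule.inner_starProjection_left_eq_right, Submodule.starProjection_eq_self_iff.2 hk]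

/-- **Step (C1) of the proof** for self-adjoint `y`: from `P(x'Ω) = P(μ x₀Ω)`,
`⟪x'Ω, yΩ⟫ = ½(μ̄⟪x₀Ω, yΩ⟫ + μ⟪yΩ, x₀Ω⟫)` ("`⟨yω, x'ω⟩ = λ⟨yω, xω⟩ + λ̄⟨xω, yω⟩`", `x = x₀/2`).
[cite: RieffelVandaele1977, Lemma 4.5 (proof)] -/
theorem inner_eq_of_sakai_sa {x' x₀ : H →L[ℂ] H} (hx'M : x' ∈ M.commutant) (hsa' : IsSelfAdjoint x')
    {μ : ℂ}
    (hP : (tomitaK M Ω).starProjection (x' Ω) = (tomitaK M Ω).starProjection (μ • x₀ Ω))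
    {y : H →L[ℂ] H} (hyM : y ∈ M) (hysa : IsSelfAdjoint y) :
    ⟪x' Ω, y Ω⟫_ℂ = 2⁻¹ * (conj μ * ⟪x₀ Ω, y Ω⟫_ℂ + μ * ⟪y Ω, x₀ Ω⟫_ℂ) := by
  -- `⟪x'Ω, yΩ⟫` is real and equals `Re(μ⟪yΩ, x₀Ω⟫)`
  have hreal : conj ⟪y Ω, x' Ω⟫_ℂ = ⟪y Ω, x' Ω⟫_ℂ := inner_apply_apply_conj hyM hysa hx'M hsa'
  have h1 : ⟪x' Ω, y Ω⟫_ℂ = ((⟪y Ω, x' Ω⟫_ℂ).re : ℂ) := by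
    rw [← inner_conj_symm, hreal]; exact (Complex.conj_eq_iff_re.1 hreal).symm
  have h2 : (⟪y Ω, x' Ω⟫_ℂ).re = (μ * ⟪y Ω, x₀ Ω⟫_ℂ).re := by
    rw [← real_inner_eq_re, real_inner_eq_inner_starProjection (apply_mem_tomitaK hyM hysa), hP,
      ← real_inner_eq_inner_starProjection (apply_mem_tomitaK hyM hysa), real_inner_eq_re, inner_smul_right]
  rw [h1, h2, Complex.re_eq_add_conj, map_mul, inner_conj_symm]
  ring

/-- **Step (C1), general `y ∈ M`** ("this relation will hold for arbitrary `y ∈ M` if we change the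
third `y` to `y*`"). [cite: RieffelVandaele1977, Lemma 4.5 (proof)] -/
theorem inner_eq_of_sakai {x' x₀ : H →L[ℂ] H} (hx'M : x' ∈ M.commutant) (hsa' : IsSelfAdjoint x')
    {μ : ℂ}
    (hP : (tomitaK M Ω).starProjection (x' Ω) = (tomitaK M Ω).starProjection (μ • x₀ Ω))
    {y : H →L[ℂ] H} (hyM : y ∈ M) :
    ⟪x' Ω, y Ω⟫_ℂ = 2⁻¹ * (conj μ * ⟪x₀ Ω, y Ω⟫_ℂ + μ * ⟪(star y) Ω, x₀ Ω⟫_ℂ) := by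
  obtain ⟨y₁, y₂, h₁M, h₂M, h₁sa, h₂sa, hdec, hdec'⟩ := exists_sa_decomp M hyM
  have e1 := inner_eq_of_sakai_sa (Ω := Ω) hx'M hsa' hP h₁M h₁sa
  have e2 := inner_eq_of_sakai_sa (Ω := Ω) hx'M hsa' hP h₂M h₂sa
  rw [hdec', hdec, add_apply, sub_apply, smul_apply, inner_add_right, inner_smul_right,
    inner_add_right, inner_smul_right, inner_sub_left, inner_smul_left, Complex.conj_I, e1, e2]
  ring

/-- **Step (C2)**: `⟪x'zΩ, yΩ⟫ = ½(μ̄⟪z x₀Ω, yΩ⟫ + μ⟪zΩ, y x₀Ω⟫)` for `y, z ∈ M` (substitute `z*y`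
for `y`). [cite: RieffelVandaele1977, Lemma 4.5 (proof)] -/
theorem inner_eq_of_sakai₂ {x' x₀ : H →L[ℂ] H} (hx'M : x' ∈ M.commutant) (hsa' : IsSelfAdjoint x')
    {μ : ℂ}
    (hP : (tomitaK M Ω).starProjection (x' Ω) = (tomitaK M Ω).starProjection (μ • x₀ Ω))
    {y z : H →L[ℂ] H} (hyM : y ∈ M) (hzM : z ∈ M) :
    ⟪x' (z Ω), y Ω⟫_ℂ = 2⁻¹ * (conj μ * ⟪z (x₀ Ω), y Ω⟫_ℂ + μ * ⟪z Ω, y (x₀ Ω)⟫_ℂ) := by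
  have h := inner_eq_of_sakai (Ω := Ω) hx'M hsa' hP (mul_mem (star_mem hzM) hyM)
  rw [mul_apply_eq_comp, ContinuousLinearMap.star_eq_adjoint, ContinuousLinearMap.adjoint_inner_right,
    ContinuousLinearMap.adjoint_inner_right, ← commutant_apply_comm hzM hx'M, star_mul,
    ← ContinuousLinearMap.star_eq_adjoint, star_star, mul_apply_eq_comp, ContinuousLinearMap.star_eq_adjoint,
    ContinuousLinearMap.adjoint_inner_left] at h
  exact h

/-- **Rieffel–van Daele, Lemma 4.5 (self-adjoint `x'`)**: for `x' ∈ M'_sa` and `Re μ > 0` there is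
`x ∈ M_sa` with `T (J x' J) T = μ̄ (2 − R) x R + μ R x (2 − R)` (`μ = λ̄` in the paper's notation).
[cite: RieffelVandaele1977, Lemma 4.5] -/
theorem commutation_lemma_sa {x' : H →L[ℂ] H} (hx'M : x' ∈ M.commutant) (hsa' : IsSelfAdjoint x')
    {μ : ℂ} (hμ : 0 < μ.re) :
    ∃ x ∈ M, IsSelfAdjoint x ∧
      modT (tomitaK M Ω) * conjJ hstd x' * modT (tomitaK M Ω) =
        conj μ • ((2 - modR (tomitaK M Ω)) * x * modR (tomitaK M Ω)) +
          μ • (modR (tomitaK M Ω) * x * (2 - modR (tomitaK M Ω))) := by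
  set K := tomitaK M Ω
  obtain ⟨x₀, hx₀M, hx₀sa, hP⟩ := sakaiRN (M := M) (Ω := Ω) hx'M hsa' hμ
  refine ⟨((2⁻¹ : ℝ) : ℂ) • x₀, M.toStarSubalgebra.smul_mem hx₀M _, ?_, ?_⟩
  · rw [IsSelfAdjoint, star_smul, hx₀sa.star_eq]; simp
  -- compare matrix elements on `M'Ω × M'Ω`
  have hcyc : IsCyclicVector M.commutant Ω := hstd.2.isCyclicVector_commutant
  refine ext_of_cyclic_commutant hcyc fun y' hy'M z' hz'M => ?_
  obtain ⟨y, hyM, hy, hy'⟩ := exists_modB_apply_eq (M := M) (Ω := Ω) hy'M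
  obtain ⟨z, hzM, hz, hz'⟩ := exists_modB_apply_eq (M := M) (Ω := Ω) hz'M
  have hRsa := modR_isSelfAdjoint K
  have hTsa := modT_isSelfAdjoint K
  have h2Rsa := two_sub_modR_isSelfAdjoint K
  have hsymT := ContinuousLinearMap.isSelfAdjoint_iff_isSymmetric.1 hTsa
  have hsymR := ContinuousLinearMap.isSelfAdjoint_iff_isSymmetric.1 hRsa
  have hsym2R := ContinuousLinearMap.isSelfAdjoint_iff_isSymmetric.1 h2Rsa
  have hsymx := ContinuousLinearMap.isSelfAdjoint_iff_isSymmetric.1 hx₀sa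
  -- left-hand side: `⟪y'Ω, T J x' J T z'Ω⟫ = ⟪x' zΩ, yΩ⟫`
  have hL : ⟪y' Ω, (modT K * conjJ hstd x' * modT K) (z' Ω)⟫_ℂ = ⟪x' (z Ω), y Ω⟫_ℂ := by
    rw [mul_apply_eq_comp, mul_apply_eq_comp, conjJ_apply]
    -- `T (J w) = J (T w)`-type rewriting: `⟪y'Ω, T (J u)⟫ = ⟪T y'Ω, J u⟫ = ⟪u, J (T y'Ω)⟫ = ⟪u, B y'Ω⟫`
    have e1 : ⟪y' Ω, modT K (tomitaJ M Ω hstd (x' (tomitaJ M Ω hstd (modT K (z' Ω)))))⟫_ℂ =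
        ⟪modT K (y' Ω), tomitaJ M Ω hstd (x' (tomitaJ M Ω hstd (modT K (z' Ω))))⟫_ℂ := by
      simpa only [ContinuousLinearMap.coe_coe] using (hsymT (y' Ω) _).symm
    rw [e1, inner_tomitaJ_swap, tomitaJ_modT, tomitaJ_modT, hy, hz]
  -- the two terms on the right
  have hM1 : ⟪z (x₀ Ω), y Ω⟫_ℂ = ⟪y' Ω, ((2 - modR K) * x₀ * modR K) (z' Ω)⟫_ℂ := by
    -- `yΩ = B y'Ω = J (T y'Ω)`; `⟪w, J(T y'Ω)⟫ = ⟪T y'Ω, J w⟫ = ⟪y'Ω, T (J w)⟫ = ⟪y'Ω, B w⟫`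
    have hw : ∀ w : H, ⟪w, y Ω⟫_ℂ = ⟪y' Ω, modB K w⟫_ℂ := fun w => by
      rw [← hy, ← tomitaJ_modT hstd, inner_tomitaJ_swap, ← modT_tomitaJ hstd]
      simpa only [ContinuousLinearMap.coe_coe] using hsymT (y' Ω) (tomitaJ M Ω hstd w)
    rw [hw, ← mul_apply_eq_comp, modB_apply_of_mem (mul_mem hzM hx₀M), star_mul, hx₀sa.star_eq,
      mul_apply_eq_comp, ← hz', modB_apply_of_mem_commutant (star_mem hz'M), star_star, mul_apply_eq_comp,
      mul_apply_eq_comp]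
  have hM2 : ⟪z Ω, y (x₀ Ω)⟫_ℂ = ⟪y' Ω, (modR K * x₀ * (2 - modR K)) (z' Ω)⟫_ℂ := by
    have hw : ∀ w : H, ⟪z Ω, w⟫_ℂ = ⟪modB K w, z' Ω⟫_ℂ := fun w => by
      rw [← inner_conj_symm, ← hz, ← tomitaJ_modT hstd, inner_tomitaJ_swap, ← modT_tomitaJ hstd]
      have : ⟪modT K (z' Ω), tomitaJ M Ω hstd w⟫_ℂ = ⟪z' Ω, modT K (tomitaJ M Ω hstd w)⟫_ℂ := by
        simpa only [ContinuousLinearMap.coe_coe] using (hsymT (z' Ω) _)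
      rw [this, inner_conj_symm]
    rw [hw, ← mul_apply_eq_comp, modB_apply_of_mem (mul_mem hyM hx₀M), star_mul, hx₀sa.star_eq,
      mul_apply_eq_comp, ← hy', modB_apply_of_mem_commutant (star_mem hy'M), star_star]
    -- `⟪(2−R) x₀ R y'Ω, z'Ω⟫ = ⟪y'Ω, R x₀ (2−R) z'Ω⟫`
    rw [mul_apply_eq_comp, mul_apply_eq_comp]
    have e1 : ⟪(2 - modR K) (x₀ (modR K (y' Ω))), z' Ω⟫_ℂ = ⟪x₀ (modR K (y' Ω)), (2 - modR K) (z' Ω)⟫_ℂ := by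
      simpa only [ContinuousLinearMap.coe_coe] using (hsym2R _ (z' Ω))
    have e2 : ⟪x₀ (modR K (y' Ω)), (2 - modR K) (z' Ω)⟫_ℂ = ⟪modR K (y' Ω), x₀ ((2 - modR K) (z' Ω))⟫_ℂ := by
      simpa only [ContinuousLinearMap.coe_coe] using (hsymx _ _)
    have e3 : ⟪modR K (y' Ω), x₀ ((2 - modR K) (z' Ω))⟫_ℂ = ⟪y' Ω, modR K (x₀ ((2 - modR K) (z' Ω)))⟫_ℂ := by
      simpa only [ContinuousLinearMap.coe_coe] using (hsymR _ _)
    rw [e1, e2, e3]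
  rw [hL, inner_eq_of_sakai₂ (Ω := Ω) hx'M hsa' hP hyM hzM, hM1, hM2]
  simp only [add_apply, smul_apply, mul_apply_eq_comp, map_smul, inner_add_right, inner_smul_right]
  push_cast
  ring

end Lemma45

end Literature.MathematicalPhysics.AQFT
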